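import Summits.QuantumFields.BalabanUV.Beta.FP.NestedStepLawOneShotJets
import Summits.QuantumFields.BalabanUV.Beta.FP.SliceTransportConjugationEnd

/-!
# `BalabanUV.Beta.FP.NestedStepLawTransported` — road «FP» for binder row D1, ROUTE T, presentation T-β (memo `N2B-DESIGN.md` §23, W-FP-17-11):
# **THE ONE-SHOT-SLICED COMPOSITE STEP LAW WITH THE TRANSPORT INSERTED FIRST** — each Faddeev–Popov determinant read in its own chart

WHAT.  `NestedStepLawOneShotJets.secondVar_oneShot_nestedStepLaw_jets` (p308750 ✓) decomposes the one-shot-sliced composite 2-jet (static one-shot comb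
slice `P`) as «fine one-step sliced (static `τ₁`) + coarse sliced (static `τ₂`, transported jets) + `2·sV(P·W) − 2·sV([τ₂Q₁;τ₁]·W)`», all twelve jets
being read along ONE insertion family.  The one-shot literal and the nested (two-step) literal dress the insertion slot by DIFFERENT static comb projectors
(`Π_big e_b` vs the nested-axial `Π_nest e_b`), i.e. their insertion families differ by an infinitesimal gauge transformation; along the one-shot family
the nested Faddeev–Popov 2-jet moves (leaf-06 `NestedSliceDeadJets`), along the nested family the one-shot one does.  T-β: transport the WHOLE composite
system first.  With field ∕ multiplier transports `A`, `Ā` (inverse field transport `A′`, letters `A′A = 1` to second order, unimodular jets) and the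
one-shot literal's composite jets NAMED as the conjugated words of the nested-chart composite jets ((T-β-1): `𝔎♯ₙ = (Aᵀ𝔎A)ₙ`, `𝔔♯ₙ = (Ā𝔔A)ₙ`):
`SliceTransportConjugationEnd.secondVar_kkt_conj_transport` (p317781 ✓) moves the static one-shot slice `P` to `P·A′(u)` in the nested chart;
`SliceExchangeJets.secondVar_kkt_slice_change_jets_of_range` (p308565 ✓) un-moves it at the price `−2·sV(P·W) + 2·sV((P·A′)·W)`; p308750 in the nested
chart adds `+2·sV(P·W) − 2·sV([τ₂Q₁;τ₁]·W)`.  THE ONE-SHOT FADDEEV–POPOV 2-JET OF THE NESTED CHART CANCELS IDENTICALLY, and the law reads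
(§1, **`secondVar_oneShot_nestedStepLaw_transported`**):

  one-shot composite 2-jet (its own chart, static `P`) = fine one-step sliced 2-jet (nested chart, static `τ₁`) + coarse sliced (as p308750)
    `+ 2·secondVar ((P·A′)·W)-jets − 2·secondVar ([τ₂Q₁;τ₁]·W)-jets`,

with the SAME composite Ward letters `a* b*` as p308750 (they are chart-covariant statements, used once, in the nested chart) and NO new (INV) letter
(the moved-slice determinant is derived from `h1 h2` by `NestedSliceExchange.det_kkt_fromRows_slice_change_of_range`).  §2
(**`secondVar_oneShot_nestedStepLaw_transported_of_letters`**): under the INTERTWINING letter (T-β-4) `(A′·W)ₙ = (W♯·C)ₙ` (the transported nested-chart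
generators are the one-shot chart's generators `W♯` re-parametrised by a unimodular `C` — `Ad(g)∘D_h = D_{h^g}∘Ad(g)` at jet level; leaf-06's
`ExponentialTransportJets` hypothesis `X·Wₙ = Wₙ·Z` is the case `W♯ = W`) and the two charts' DEAD-ROW letters — `P·W♯₁ = P·W♯₂ = 0` (the one-shot
slice reads big-comb bonds, dead along the one-shot family) and `τ₁·W₁ = τ₁·W₂ = 0`, `τ₂·(Q₁W)₁ = τ₂·(Q₁W)₂ = 0` (the nested slice reads small-comb bonds
and coarse-comb bonds of the average, dead along the nested family) — BOTH displayed Faddeev–Popov 2-jets VANISH: the finite-`j` law is EXACT WITH ZERO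
DEFECT, no forest ∕ Haar letter, no `UltralocalDefect`.  [folklore] composition BY NAME of p308750, p317781, p308565 and `secondVar_mul₂`; no `def`,
no `def … : Prop`, nothing cited, 0 sorry.  The letters (T-β-1…4), the dead-row letters and p308750's table identities are the dictionary's (leaf-02 ∕
leaf-06 ∕ an2), displayed here as hypotheses; the torus instance is the successor file.

HONEST DEPENDENCY (page 1, mandatory): continuum YM on T⁴ ⇐ BetaPertH ∧ nine spine estimates (0/9 proved); BetaPertH ⇐ (D1) ∧ (D4) ∧ CAP+tail;
G-an2-4 gates asym, D1 and NE2/3/4.  HONEST FRAMING (cell contract, verbatim): «discharging `BetaPertH` makes Bałaban's UV stability UNCONDITIONAL —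
a real constructive-QFT result; it is NOT the continuum limit and NOT the Clay problem.»  ABSOLUTE RULE (cell charter, verbatim): «No internally-minted
statement may enter as a cited fact. Every hypothesis is either kernel-proved in this package or a verbatim quotation of a PUBLISHED theorem with page
reference. The manuscript(s) under audit are NOT citable for their own disputed steps — they are the thing under adjudication; programme-internal
(2001/route/tribunal) claims are never citable.»  0∕4 row-D1 binders; NOT (T-ID), NOT SDF, NOT D1, NOT BetaPertH, NOT continuum, NOT Clay.
Road «FP» OWNER, b2b-balaban-beta-d1-p3 gen 18, 2026-08-22.  No existing file touched.
-/

noncomputable section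

namespace Summit.QuantumFields.BalabanUV.Beta.FP.NestedStepLawTransported

open Matrix Finset
open Literature.MathematicalPhysics.QuantumFieldTheory.Balaban1983to89.Beta.Composition (kkt)
open Literature.MathematicalPhysics.QuantumFieldTheory.Balaban1983to89.Beta.CompositionSingular (effForm flucCov minOp minOpL)
open Literature.MathematicalPhysics.QuantumFieldTheory.Balaban1983to89.Beta.SliceComposition (det_kkt_reindex fromRows_assoc)
open Summit.QuantumFields.BalabanUV.Beta.D1BFx.LogDetSecondVariation (secondVar)
open Summit.QuantumFields.BalabanUV.Beta.FP.NestedStepLawOneShot (det_kkt_compSliced_ne_zero)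
open Summit.QuantumFields.BalabanUV.Beta.FP.NestedStepLawOneShotJets (secondVar_oneShot_nestedStepLaw_jets)
open Summit.QuantumFields.BalabanUV.Beta.FP.NestedSliceExchange (det_kkt_fromRows_slice_change_of_range)
open Summit.QuantumFields.BalabanUV.Beta.FP.SliceExchangeJets (secondVar_kkt_slice_change_jets_of_range)
open Summit.QuantumFields.BalabanUV.Beta.FP.SliceTransportConjugation (secondVar_mul₂ fromRows_add')
open Summit.QuantumFields.BalabanUV.Beta.FP.SliceTransportConjugationEnd (secondVar_kkt_conj_transport)
open Summit.QuantumFields.BalabanUV.Beta.FP.CombSliceJetLetters (secondVar_zero_jets)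

variable {ν μ κ ρ₁ ρ₂ : Type*} [Fintype ν] [Fintype μ] [Fintype κ] [Fintype ρ₁] [Fintype ρ₂]
  [DecidableEq ν] [DecidableEq μ] [DecidableEq κ] [DecidableEq ρ₁] [DecidableEq ρ₂]

/-! ## §1 The transported law with the two chart-native Faddeev–Popov 2-jets displayed -/

/-- [folklore] **THE ONE-SHOT-SLICED COMPOSITE STEP LAW, TRANSPORT FIRST (T-β).**  Data and letters of `secondVar_oneShot_nestedStepLaw_jets` (p308750) read in
the NESTED chart, plus: field ∕ multiplier transport 2-jets `A`, `Ā`, the inverse field transport `A′` (`A′A = 1` to second order), UNIMODULAR at jet level;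
the one-shot literal's composite jets `𝔎♯ₙ`, `𝔔♯ₙ` NAMED as the conjugated words (T-β-1); the moved one-shot Faddeev–Popov operator `P·A′₀·W₀`
non-degenerate.  CONCLUSION: the one-shot composite sliced 2-jet (static slice `P`, its own chart) `=` fine one-step sliced `+` coarse sliced (verbatim
p308750) `+ 2·secondVar ((P·A′)·W)-jets − 2·secondVar ([τ₂Q₁;τ₁]·W)-jets` — the nested chart's one-shot Faddeev–Popov 2-jet has CANCELLED. -/
theorem secondVar_oneShot_nestedStepLaw_transported
    (H₀ H₁ H₂ : Matrix ν ν ℝ) (Q₁₀ Q₁₁ Q₁₂ : Matrix μ ν ℝ) (Q₂₀ Q₂₁ Q₂₂ : Matrix κ μ ℝ) (G₀ G₁ G₂ : Matrix μ μ ℝ)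
    (τ₁ : Matrix ρ₁ ν ℝ) (τ₂ : Matrix ρ₂ μ ℝ) (P : Matrix (ρ₂ ⊕ ρ₁) ν ℝ) (W₀ W₁ W₂ : Matrix ν (ρ₂ ⊕ ρ₁) ℝ) (Y₀ Y₁ Y₂ Y'₀ Y'₁ Y'₂ : Matrix κ (ρ₂ ⊕ ρ₁) ℝ)
    -- the transports: fields `A` (inverse `A'`), composite multipliers `Ā` — 2-jets
    (A₀ A₁ A₂ A'₀ A'₁ A'₂ : Matrix ν ν ℝ) (Ā₀ Ā₁ Ā₂ : Matrix κ κ ℝ)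
    -- the composite jets of the NESTED chart, NAMED (as p308750)
    {𝔎₀ 𝔎₁ 𝔎₂ : Matrix ν ν ℝ} {𝔔₀ 𝔔₁ 𝔔₂ : Matrix κ ν ℝ}
    (h𝔎₀ : H₀ + Q₁₀ᵀ * G₀ * Q₁₀ = 𝔎₀) (h𝔎₁ : H₁ + (Q₁₁ᵀ * G₀ * Q₁₀ + Q₁₀ᵀ * G₁ * Q₁₀ + Q₁₀ᵀ * G₀ * Q₁₁) = 𝔎₁)
    (h𝔎₂ : H₂ + ((Q₁₂ᵀ * G₀ * Q₁₀ + Q₁₁ᵀ * G₁ * Q₁₀ + Q₁₁ᵀ * G₀ * Q₁₁) + (Q₁₁ᵀ * G₁ * Q₁₀ + Q₁₀ᵀ * G₂ * Q₁₀ + Q₁₀ᵀ * G₁ * Q₁₁)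
            + (Q₁₁ᵀ * G₀ * Q₁₁ + Q₁₀ᵀ * G₁ * Q₁₁ + Q₁₀ᵀ * G₀ * Q₁₂)) = 𝔎₂)
    (h𝔔₀ : Q₂₀ * Q₁₀ = 𝔔₀) (h𝔔₁ : Q₂₁ * Q₁₀ + Q₂₀ * Q₁₁ = 𝔔₁) (h𝔔₂ : Q₂₂ * Q₁₀ + Q₂₁ * Q₁₁ + (Q₂₁ * Q₁₁ + Q₂₀ * Q₁₂) = 𝔔₂)
    -- (T-β-1) the ONE-SHOT literal's composite jets are the conjugated words, NAMED
    {𝔎'₀ 𝔎'₁ 𝔎'₂ : Matrix ν ν ℝ} {𝔔'₀ 𝔔'₁ 𝔔'₂ : Matrix κ ν ℝ}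
    (k0 : A₀ᵀ * 𝔎₀ * A₀ = 𝔎'₀) (k1 : A₁ᵀ * 𝔎₀ * A₀ + A₀ᵀ * 𝔎₁ * A₀ + A₀ᵀ * 𝔎₀ * A₁ = 𝔎'₁)
    (k2 : A₂ᵀ * 𝔎₀ * A₀ + (A₁ᵀ * 𝔎₁ * A₀ + A₁ᵀ * 𝔎₀ * A₁)
            + ((A₁ᵀ * 𝔎₁ * A₀ + A₁ᵀ * 𝔎₀ * A₁) + (A₀ᵀ * 𝔎₂ * A₀ + A₀ᵀ * 𝔎₁ * A₁ + (A₀ᵀ * 𝔎₁ * A₁ + A₀ᵀ * 𝔎₀ * A₂))) = 𝔎'₂)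
    (q0 : Ā₀ * 𝔔₀ * A₀ = 𝔔'₀) (q1 : Ā₁ * 𝔔₀ * A₀ + Ā₀ * 𝔔₁ * A₀ + Ā₀ * 𝔔₀ * A₁ = 𝔔'₁)
    (q2 : Ā₂ * 𝔔₀ * A₀ + (Ā₁ * 𝔔₁ * A₀ + Ā₁ * 𝔔₀ * A₁)
            + ((Ā₁ * 𝔔₁ * A₀ + Ā₁ * 𝔔₀ * A₁) + (Ā₀ * 𝔔₂ * A₀ + Ā₀ * 𝔔₁ * A₁ + (Ā₀ * 𝔔₁ * A₁ + Ā₀ * 𝔔₀ * A₂))) = 𝔔'₂)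
    -- (T-β-2) unimodular transports, (T-β-3) inverse letters
    (hA : A₀.det ≠ 0) (hĀ : Ā₀.det ≠ 0)
    (i0 : A'₀ * A₀ = 1) (i1 : A'₁ * A₀ + A'₀ * A₁ = 0) (i2 : A'₂ * A₀ + (2 : ℝ) • (A'₁ * A₁) + A'₀ * A₂ = 0)
    (uA : secondVar A₀ A₁ A₂ = 0) (uĀ : secondVar Ā₀ Ā₁ Ā₂ = 0)
    -- Ward letters of the composite system to second order at `0`, NESTED chart (as p308750)
    (a0 : 𝔎₀ * W₀ = 𝔔₀ᵀ * Y₀) (a1 : 𝔎₁ * W₀ + 𝔎₀ * W₁ = 𝔔₁ᵀ * Y₀ + 𝔔₀ᵀ * Y₁)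
    (a2 : 𝔎₂ * W₀ + (2 : ℝ) • (𝔎₁ * W₁) + 𝔎₀ * W₂ = 𝔔₂ᵀ * Y₀ + (2 : ℝ) • (𝔔₁ᵀ * Y₁) + 𝔔₀ᵀ * Y₂)
    (a0t : 𝔎₀ᵀ * W₀ = 𝔔₀ᵀ * Y'₀) (a1t : 𝔎₁ᵀ * W₀ + 𝔎₀ᵀ * W₁ = 𝔔₁ᵀ * Y'₀ + 𝔔₀ᵀ * Y'₁)
    (a2t : 𝔎₂ᵀ * W₀ + (2 : ℝ) • (𝔎₁ᵀ * W₁) + 𝔎₀ᵀ * W₂ = 𝔔₂ᵀ * Y'₀ + (2 : ℝ) • (𝔔₁ᵀ * Y'₁) + 𝔔₀ᵀ * Y'₂)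
    (b0 : 𝔔₀ * W₀ = 0) (b1 : 𝔔₁ * W₀ + 𝔔₀ * W₁ = 0) (b2 : 𝔔₂ * W₀ + (2 : ℝ) • (𝔔₁ * W₁) + 𝔔₀ * W₂ = 0)
    -- the three Faddeev–Popov operators at `0` are non-degenerate (one-shot, nested, moved one-shot)
    (hPW : (P * W₀).det ≠ 0) (hTW : (fromRows (τ₂ * Q₁₀) τ₁ * W₀).det ≠ 0) (hPAW : (P * A'₀ * W₀).det ≠ 0)
    -- blocks of the inverse of the fine sliced system and the sliced border jet, NAMED (as p308750)
    {Γ : Matrix ν ν ℝ} {I : Matrix ν (μ ⊕ ρ₁) ℝ} {L : Matrix (μ ⊕ ρ₁) ν ℝ} {S : Matrix (μ ⊕ ρ₁) (μ ⊕ ρ₁) ℝ} {B : Matrix (μ ⊕ ρ₁) ν ℝ}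
    (hΓ : flucCov H₀ (fromRows Q₁₀ τ₁) = Γ) (hI : minOp H₀ (fromRows Q₁₀ τ₁) = I) (hL : minOpL H₀ (fromRows Q₁₀ τ₁) = L) (hS : effForm H₀ (fromRows Q₁₀ τ₁) = S)
    (hB : fromRows Q₁₁ (0 : Matrix ρ₁ ν ℝ) = B)
    -- (INV) (as p308750)
    (h1 : (kkt H₀ (fromRows Q₁₀ τ₁)).det ≠ 0)
    (h2 : (kkt (S.toBlocks₁₁ + G₀) (fromRows Q₂₀ τ₂)).det ≠ 0) :
    secondVar (kkt 𝔎'₀ (fromRows 𝔔'₀ P)) (kkt 𝔎'₁ (fromRows 𝔔'₁ (0 : Matrix (ρ₂ ⊕ ρ₁) ν ℝ))) (kkt 𝔎'₂ (fromRows 𝔔'₂ (0 : Matrix (ρ₂ ⊕ ρ₁) ν ℝ)))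
      = secondVar (kkt H₀ (fromRows Q₁₀ τ₁)) (kkt H₁ B) (kkt H₂ (fromRows Q₁₂ (0 : Matrix ρ₁ ν ℝ)))
        + secondVar
            (kkt (S.toBlocks₁₁ + G₀) (fromRows Q₂₀ τ₂))
            (kkt (((L * H₁ - S * B) * I - L * Bᵀ * S).toBlocks₁₁ + G₁) (fromRows Q₂₁ (0 : Matrix ρ₂ μ ℝ)))
            (kkt ((((-((L * H₁ - S * B) * Γ + L * Bᵀ * L) * H₁ + L * H₂
                      - (((L * H₁ - S * B) * I - L * Bᵀ * S) * B + S * fromRows Q₁₂ (0 : Matrix ρ₁ ν ℝ))) * I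
                    + (L * H₁ - S * B) * (-((Γ * H₁ + I * B) * I - Γ * Bᵀ * S)))
                  - ((-((L * H₁ - S * B) * Γ + L * Bᵀ * L) * Bᵀ + L * (fromRows Q₁₂ (0 : Matrix ρ₁ ν ℝ))ᵀ) * S
                      + L * Bᵀ * ((L * H₁ - S * B) * I - L * Bᵀ * S))).toBlocks₁₁ + G₂)
              (fromRows Q₂₂ (0 : Matrix ρ₂ μ ℝ)))
        + (2 * secondVar (P * A'₀ * W₀) (P * A'₁ * W₀ + P * A'₀ * W₁) (P * A'₂ * W₀ + P * A'₁ * W₁ + (P * A'₁ * W₁ + P * A'₀ * W₂))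
          - 2 * secondVar (fromRows (τ₂ * Q₁₀) τ₁ * W₀) (fromRows (τ₂ * Q₁₁) (0 : Matrix ρ₁ ν ℝ) * W₀ + fromRows (τ₂ * Q₁₀) τ₁ * W₁)
              (fromRows (τ₂ * Q₁₂) (0 : Matrix ρ₁ ν ℝ) * W₀ + fromRows (τ₂ * Q₁₁) (0 : Matrix ρ₁ ν ℝ) * W₁
                + (fromRows (τ₂ * Q₁₁) (0 : Matrix ρ₁ ν ℝ) * W₁ + fromRows (τ₂ * Q₁₀) τ₁ * W₂))) := by
  -- the nested-sliced composite system is non-degenerate at `0` (rows regrouped `[𝔔₀; [τ₂Q₁₀; τ₁]]`)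
  have h0 : (kkt 𝔎₀ (fromRows 𝔔₀ (fromRows (τ₂ * Q₁₀) τ₁))).det ≠ 0 := by
    rw [← h𝔎₀, ← h𝔔₀, fromRows_assoc, det_kkt_reindex]
    exact det_kkt_compSliced_ne_zero H₀ Q₁₀ Q₂₀ G₀ τ₁ τ₂ hS h1 h2
  -- hence so is the composite system sliced by the MOVED one-shot slice `P·A'₀` (slice change at order 0, no new (INV) letter)
  have hM : (kkt 𝔎₀ (fromRows 𝔔₀ (P * A'₀))).det ≠ 0 := by
    have hid := det_kkt_fromRows_slice_change_of_range 𝔎₀ 𝔔₀ (fromRows (τ₂ * Q₁₀) τ₁) (P * A'₀) W₀ Y₀ Y'₀ a0 a0t b0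
      (isUnit_iff_ne_zero.2 hTW) (isUnit_iff_ne_zero.2 hPAW)
    intro hz
    rw [hz, zero_mul] at hid
    exact (mul_ne_zero h0 (pow_ne_zero 2 hPAW)) hid.symm
  -- (T-β) conjugation transport: the one-shot literal's sliced 2-jet (static `P`) = the nested-chart 2-jet with the slice MOVED to `P·A'`
  have conj := secondVar_kkt_conj_transport A₀ A₁ A₂ A'₀ A'₁ A'₂ 𝔎₀ 𝔎₁ 𝔎₂ Ā₀ Ā₁ Ā₂ 𝔔₀ 𝔔₁ 𝔔₂ P hA hĀ hM i0 i1 i2 uA uĀ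
  rw [k2, k1, k0, q2, q1, q0] at conj
  -- un-move the slice in the nested chart (static `P` ↔ moving `P·A'`), Faddeev–Popov pair displayed
  have exch := secondVar_kkt_slice_change_jets_of_range 𝔎₀ 𝔎₁ 𝔎₂ 𝔔₀ 𝔔₁ 𝔔₂ (P * A'₀) (P * A'₁) (P * A'₂) P W₀ W₁ W₂ Y₀ Y₁ Y₂ Y'₀ Y'₁ Y'₂
    a0 a1 a2 a0t a1t a2t b0 b1 b2 hPW hPAW hM
  -- p308750 in the nested chart
  have main := secondVar_oneShot_nestedStepLaw_jets H₀ H₁ H₂ Q₁₀ Q₁₁ Q₁₂ Q₂₀ Q₂₁ Q₂₂ G₀ G₁ G₂ τ₁ τ₂ P W₀ W₁ W₂ Y₀ Y₁ Y₂ Y'₀ Y'₁ Y'₂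
    h𝔎₀ h𝔎₁ h𝔎₂ h𝔔₀ h𝔔₁ h𝔔₂ a0 a1 a2 a0t a1t a2t b0 b1 b2 hPW hTW hΓ hI hL hS hB h1 h2
  rw [conj]
  linarith

/-! ## §2 Under the intertwining and dead-row letters both Faddeev–Popov 2-jets vanish: ZERO defect -/

omit [Fintype κ] [Fintype ρ₁] [Fintype ρ₂] [DecidableEq ν] [DecidableEq μ] [DecidableEq κ] [DecidableEq ρ₁] [DecidableEq ρ₂] in
/-- [folklore] the first jet of the nested Faddeev–Popov operator vanishes on the nested chart's dead rows. -/
theorem nestedFP_jet₁_eq_zero (τ₁ : Matrix ρ₁ ν ℝ) (τ₂ : Matrix ρ₂ μ ℝ) (Q₁₀ Q₁₁ : Matrix μ ν ℝ) (W₀ W₁ : Matrix ν (ρ₂ ⊕ ρ₁) ℝ)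
    (s1 : τ₁ * W₁ = 0) (t1 : τ₂ * (Q₁₁ * W₀ + Q₁₀ * W₁) = 0) :
    fromRows (τ₂ * Q₁₁) (0 : Matrix ρ₁ ν ℝ) * W₀ + fromRows (τ₂ * Q₁₀) τ₁ * W₁ = 0 := by
  rw [Matrix.fromRows_mul, Matrix.fromRows_mul, fromRows_add', Matrix.zero_mul, zero_add, s1, Matrix.mul_assoc, Matrix.mul_assoc,
    ← Matrix.mul_add, t1, Matrix.fromRows_zero]

omit [Fintype κ] [Fintype ρ₁] [Fintype ρ₂] [DecidableEq ν] [DecidableEq μ] [DecidableEq κ] [DecidableEq ρ₁] [DecidableEq ρ₂] in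
/-- [folklore] the second jet of the nested Faddeev–Popov operator vanishes on the nested chart's dead rows. -/
theorem nestedFP_jet₂_eq_zero (τ₁ : Matrix ρ₁ ν ℝ) (τ₂ : Matrix ρ₂ μ ℝ) (Q₁₀ Q₁₁ Q₁₂ : Matrix μ ν ℝ) (W₀ W₁ W₂ : Matrix ν (ρ₂ ⊕ ρ₁) ℝ)
    (s2 : τ₁ * W₂ = 0) (t2 : τ₂ * (Q₁₂ * W₀ + (2 : ℝ) • (Q₁₁ * W₁) + Q₁₀ * W₂) = 0) :
    fromRows (τ₂ * Q₁₂) (0 : Matrix ρ₁ ν ℝ) * W₀ + fromRows (τ₂ * Q₁₁) (0 : Matrix ρ₁ ν ℝ) * W₁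
        + (fromRows (τ₂ * Q₁₁) (0 : Matrix ρ₁ ν ℝ) * W₁ + fromRows (τ₂ * Q₁₀) τ₁ * W₂) = 0 := by
  have t2' : τ₂ * (Q₁₂ * W₀) + τ₂ * (Q₁₁ * W₁) + (τ₂ * (Q₁₁ * W₁) + τ₂ * (Q₁₀ * W₂)) = 0 := by
    rw [← t2, two_smul, Matrix.mul_add, Matrix.mul_add, Matrix.mul_add]; abel
  rw [Matrix.fromRows_mul, Matrix.fromRows_mul, Matrix.fromRows_mul, fromRows_add', fromRows_add', fromRows_add',
    Matrix.mul_assoc, Matrix.mul_assoc, Matrix.mul_assoc, t2', s2]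
  simp only [Matrix.zero_mul, add_zero, Matrix.fromRows_zero]

omit [Fintype κ] [DecidableEq ν] [DecidableEq μ] [DecidableEq κ] in
/-- [folklore] **THE NESTED FADDEEV–POPOV 2-JET VANISHES IN THE NESTED CHART** (dead-row letters: `τ₁·W₁ = τ₁·W₂ = 0`, `τ₂·(Q₁W)₁ = τ₂·(Q₁W)₂ = 0`). -/
theorem secondVar_nestedFP_eq_zero (τ₁ : Matrix ρ₁ ν ℝ) (τ₂ : Matrix ρ₂ μ ℝ) (Q₁₀ Q₁₁ Q₁₂ : Matrix μ ν ℝ) (W₀ W₁ W₂ : Matrix ν (ρ₂ ⊕ ρ₁) ℝ)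
    (s1 : τ₁ * W₁ = 0) (s2 : τ₁ * W₂ = 0) (t1 : τ₂ * (Q₁₁ * W₀ + Q₁₀ * W₁) = 0) (t2 : τ₂ * (Q₁₂ * W₀ + (2 : ℝ) • (Q₁₁ * W₁) + Q₁₀ * W₂) = 0) :
    secondVar (fromRows (τ₂ * Q₁₀) τ₁ * W₀) (fromRows (τ₂ * Q₁₁) (0 : Matrix ρ₁ ν ℝ) * W₀ + fromRows (τ₂ * Q₁₀) τ₁ * W₁)
        (fromRows (τ₂ * Q₁₂) (0 : Matrix ρ₁ ν ℝ) * W₀ + fromRows (τ₂ * Q₁₁) (0 : Matrix ρ₁ ν ℝ) * W₁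
          + (fromRows (τ₂ * Q₁₁) (0 : Matrix ρ₁ ν ℝ) * W₁ + fromRows (τ₂ * Q₁₀) τ₁ * W₂)) = 0 := by
  rw [nestedFP_jet₁_eq_zero τ₁ τ₂ Q₁₀ Q₁₁ W₀ W₁ s1 t1, nestedFP_jet₂_eq_zero τ₁ τ₂ Q₁₀ Q₁₁ Q₁₂ W₀ W₁ W₂ s2 t2]
  exact secondVar_zero_jets _

omit [Fintype μ] [Fintype κ] [DecidableEq ν] [DecidableEq μ] [DecidableEq κ] in
/-- [folklore] **THE MOVED ONE-SHOT FADDEEV–POPOV 2-JET VANISHES UNDER THE INTERTWINING LETTER** (T-β-4): `(A′·W)ₙ = (W♯·C)ₙ` with `C` unimodular at jet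
level and `P·W♯₁ = P·W♯₂ = 0` (the one-shot slice reads rows dead along the one-shot family) ⇒ `secondVar ((P·A′)·W)-jets = 0`. -/
theorem secondVar_movedOneShotFP_eq_zero (P : Matrix (ρ₂ ⊕ ρ₁) ν ℝ) (W₀ W₁ W₂ W'₀ W'₁ W'₂ : Matrix ν (ρ₂ ⊕ ρ₁) ℝ) (A'₀ A'₁ A'₂ : Matrix ν ν ℝ)
    (C₀ C₁ C₂ : Matrix (ρ₂ ⊕ ρ₁) (ρ₂ ⊕ ρ₁) ℝ)
    (j0 : A'₀ * W₀ = W'₀ * C₀) (j1 : A'₁ * W₀ + A'₀ * W₁ = W'₁ * C₀ + W'₀ * C₁)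
    (j2 : A'₂ * W₀ + (2 : ℝ) • (A'₁ * W₁) + A'₀ * W₂ = W'₂ * C₀ + (2 : ℝ) • (W'₁ * C₁) + W'₀ * C₂)
    (hPW' : (P * W'₀).det ≠ 0) (hC : C₀.det ≠ 0) (uC : secondVar C₀ C₁ C₂ = 0) (p1 : P * W'₁ = 0) (p2 : P * W'₂ = 0) :
    secondVar (P * A'₀ * W₀) (P * A'₁ * W₀ + P * A'₀ * W₁) (P * A'₂ * W₀ + P * A'₁ * W₁ + (P * A'₁ * W₁ + P * A'₀ * W₂)) = 0 := by
  have w0 : P * A'₀ * W₀ = P * W'₀ * C₀ := by rw [Matrix.mul_assoc, j0, ← Matrix.mul_assoc]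
  have w1 : P * A'₁ * W₀ + P * A'₀ * W₁ = P * W'₁ * C₀ + P * W'₀ * C₁ := by
    rw [Matrix.mul_assoc, Matrix.mul_assoc, ← Matrix.mul_add, j1, Matrix.mul_add, ← Matrix.mul_assoc, ← Matrix.mul_assoc]
  have w2 : P * A'₂ * W₀ + P * A'₁ * W₁ + (P * A'₁ * W₁ + P * A'₀ * W₂) = P * W'₂ * C₀ + P * W'₁ * C₁ + (P * W'₁ * C₁ + P * W'₀ * C₂) := by
    have e : P * (A'₂ * W₀ + (2 : ℝ) • (A'₁ * W₁) + A'₀ * W₂) = P * (W'₂ * C₀ + (2 : ℝ) • (W'₁ * C₁) + W'₀ * C₂) := by rw [j2]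
    simp only [Matrix.mul_add, two_smul, ← Matrix.mul_assoc] at e
    calc P * A'₂ * W₀ + P * A'₁ * W₁ + (P * A'₁ * W₁ + P * A'₀ * W₂)
        = P * A'₂ * W₀ + (P * A'₁ * W₁ + P * A'₁ * W₁) + P * A'₀ * W₂ := by abel
      _ = P * W'₂ * C₀ + (P * W'₁ * C₁ + P * W'₁ * C₁) + P * W'₀ * C₂ := e
      _ = P * W'₂ * C₀ + P * W'₁ * C₁ + (P * W'₁ * C₁ + P * W'₀ * C₂) := by abel
  rw [w0, w1, w2, secondVar_mul₂ (P * W'₀) (P * W'₁) (P * W'₂) C₀ C₁ C₂ hPW' hC, uC, add_zero, p1, p2]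
  exact secondVar_zero_jets _

/-- [folklore] **THE ONE-SHOT-SLICED COMPOSITE STEP LAW, TRANSPORT FIRST, UNDER THE LETTERS: ZERO DEFECT.**  As §1, with the moved-slice non-degeneracy
REPLACED by the one-shot chart's (`det(P·W♯₀) ≠ 0`, `det C₀ ≠ 0`) and in addition: (T-β-4) the intertwining letter `(A′·W)ₙ = (W♯·C)ₙ`, `secondVar C-jets = 0`;
the one-shot chart's dead rows `P·W♯₁ = P·W♯₂ = 0`; the nested chart's dead rows `τ₁·W₁ = τ₁·W₂ = 0`, `τ₂·(Q₁₁W₀ + Q₁₀W₁) = 0`,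
`τ₂·(Q₁₂W₀ + 2•Q₁₁W₁ + Q₁₀W₂) = 0`.  CONCLUSION: one-shot composite sliced 2-jet `=` fine one-step sliced `+` coarse sliced — EXACTLY. -/
theorem secondVar_oneShot_nestedStepLaw_transported_of_letters
    (H₀ H₁ H₂ : Matrix ν ν ℝ) (Q₁₀ Q₁₁ Q₁₂ : Matrix μ ν ℝ) (Q₂₀ Q₂₁ Q₂₂ : Matrix κ μ ℝ) (G₀ G₁ G₂ : Matrix μ μ ℝ)
    (τ₁ : Matrix ρ₁ ν ℝ) (τ₂ : Matrix ρ₂ μ ℝ) (P : Matrix (ρ₂ ⊕ ρ₁) ν ℝ) (W₀ W₁ W₂ : Matrix ν (ρ₂ ⊕ ρ₁) ℝ) (Y₀ Y₁ Y₂ Y'₀ Y'₁ Y'₂ : Matrix κ (ρ₂ ⊕ ρ₁) ℝ)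
    (A₀ A₁ A₂ A'₀ A'₁ A'₂ : Matrix ν ν ℝ) (Ā₀ Ā₁ Ā₂ : Matrix κ κ ℝ)
    -- the one-shot chart's generator jets and the parameter transport (T-β-4)
    (W'₀ W'₁ W'₂ : Matrix ν (ρ₂ ⊕ ρ₁) ℝ) (C₀ C₁ C₂ : Matrix (ρ₂ ⊕ ρ₁) (ρ₂ ⊕ ρ₁) ℝ)
    {𝔎₀ 𝔎₁ 𝔎₂ : Matrix ν ν ℝ} {𝔔₀ 𝔔₁ 𝔔₂ : Matrix κ ν ℝ}
    (h𝔎₀ : H₀ + Q₁₀ᵀ * G₀ * Q₁₀ = 𝔎₀) (h𝔎₁ : H₁ + (Q₁₁ᵀ * G₀ * Q₁₀ + Q₁₀ᵀ * G₁ * Q₁₀ + Q₁₀ᵀ * G₀ * Q₁₁) = 𝔎₁)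
    (h𝔎₂ : H₂ + ((Q₁₂ᵀ * G₀ * Q₁₀ + Q₁₁ᵀ * G₁ * Q₁₀ + Q₁₁ᵀ * G₀ * Q₁₁) + (Q₁₁ᵀ * G₁ * Q₁₀ + Q₁₀ᵀ * G₂ * Q₁₀ + Q₁₀ᵀ * G₁ * Q₁₁)
            + (Q₁₁ᵀ * G₀ * Q₁₁ + Q₁₀ᵀ * G₁ * Q₁₁ + Q₁₀ᵀ * G₀ * Q₁₂)) = 𝔎₂)
    (h𝔔₀ : Q₂₀ * Q₁₀ = 𝔔₀) (h𝔔₁ : Q₂₁ * Q₁₀ + Q₂₀ * Q₁₁ = 𝔔₁) (h𝔔₂ : Q₂₂ * Q₁₀ + Q₂₁ * Q₁₁ + (Q₂₁ * Q₁₁ + Q₂₀ * Q₁₂) = 𝔔₂)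
    {𝔎'₀ 𝔎'₁ 𝔎'₂ : Matrix ν ν ℝ} {𝔔'₀ 𝔔'₁ 𝔔'₂ : Matrix κ ν ℝ}
    (k0 : A₀ᵀ * 𝔎₀ * A₀ = 𝔎'₀) (k1 : A₁ᵀ * 𝔎₀ * A₀ + A₀ᵀ * 𝔎₁ * A₀ + A₀ᵀ * 𝔎₀ * A₁ = 𝔎'₁)
    (k2 : A₂ᵀ * 𝔎₀ * A₀ + (A₁ᵀ * 𝔎₁ * A₀ + A₁ᵀ * 𝔎₀ * A₁)
            + ((A₁ᵀ * 𝔎₁ * A₀ + A₁ᵀ * 𝔎₀ * A₁) + (A₀ᵀ * 𝔎₂ * A₀ + A₀ᵀ * 𝔎₁ * A₁ + (A₀ᵀ * 𝔎₁ * A₁ + A₀ᵀ * 𝔎₀ * A₂))) = 𝔎'₂)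
    (q0 : Ā₀ * 𝔔₀ * A₀ = 𝔔'₀) (q1 : Ā₁ * 𝔔₀ * A₀ + Ā₀ * 𝔔₁ * A₀ + Ā₀ * 𝔔₀ * A₁ = 𝔔'₁)
    (q2 : Ā₂ * 𝔔₀ * A₀ + (Ā₁ * 𝔔₁ * A₀ + Ā₁ * 𝔔₀ * A₁)
            + ((Ā₁ * 𝔔₁ * A₀ + Ā₁ * 𝔔₀ * A₁) + (Ā₀ * 𝔔₂ * A₀ + Ā₀ * 𝔔₁ * A₁ + (Ā₀ * 𝔔₁ * A₁ + Ā₀ * 𝔔₀ * A₂))) = 𝔔'₂)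
    (hA : A₀.det ≠ 0) (hĀ : Ā₀.det ≠ 0)
    (i0 : A'₀ * A₀ = 1) (i1 : A'₁ * A₀ + A'₀ * A₁ = 0) (i2 : A'₂ * A₀ + (2 : ℝ) • (A'₁ * A₁) + A'₀ * A₂ = 0)
    (uA : secondVar A₀ A₁ A₂ = 0) (uĀ : secondVar Ā₀ Ā₁ Ā₂ = 0)
    -- (T-β-4) intertwining: the transported nested-chart generators are the one-shot chart's generators re-parametrised by a unimodular `C`
    (j0 : A'₀ * W₀ = W'₀ * C₀) (j1 : A'₁ * W₀ + A'₀ * W₁ = W'₁ * C₀ + W'₀ * C₁)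
    (j2 : A'₂ * W₀ + (2 : ℝ) • (A'₁ * W₁) + A'₀ * W₂ = W'₂ * C₀ + (2 : ℝ) • (W'₁ * C₁) + W'₀ * C₂)
    (hC : C₀.det ≠ 0) (uC : secondVar C₀ C₁ C₂ = 0)
    -- dead rows: the one-shot slice along the one-shot family; the nested slice along the nested family
    (p1 : P * W'₁ = 0) (p2 : P * W'₂ = 0)
    (s1 : τ₁ * W₁ = 0) (s2 : τ₁ * W₂ = 0) (t1 : τ₂ * (Q₁₁ * W₀ + Q₁₀ * W₁) = 0) (t2 : τ₂ * (Q₁₂ * W₀ + (2 : ℝ) • (Q₁₁ * W₁) + Q₁₀ * W₂) = 0)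
    (a0 : 𝔎₀ * W₀ = 𝔔₀ᵀ * Y₀) (a1 : 𝔎₁ * W₀ + 𝔎₀ * W₁ = 𝔔₁ᵀ * Y₀ + 𝔔₀ᵀ * Y₁)
    (a2 : 𝔎₂ * W₀ + (2 : ℝ) • (𝔎₁ * W₁) + 𝔎₀ * W₂ = 𝔔₂ᵀ * Y₀ + (2 : ℝ) • (𝔔₁ᵀ * Y₁) + 𝔔₀ᵀ * Y₂)
    (a0t : 𝔎₀ᵀ * W₀ = 𝔔₀ᵀ * Y'₀) (a1t : 𝔎₁ᵀ * W₀ + 𝔎₀ᵀ * W₁ = 𝔔₁ᵀ * Y'₀ + 𝔔₀ᵀ * Y'₁)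
    (a2t : 𝔎₂ᵀ * W₀ + (2 : ℝ) • (𝔎₁ᵀ * W₁) + 𝔎₀ᵀ * W₂ = 𝔔₂ᵀ * Y'₀ + (2 : ℝ) • (𝔔₁ᵀ * Y'₁) + 𝔔₀ᵀ * Y'₂)
    (b0 : 𝔔₀ * W₀ = 0) (b1 : 𝔔₁ * W₀ + 𝔔₀ * W₁ = 0) (b2 : 𝔔₂ * W₀ + (2 : ℝ) • (𝔔₁ * W₁) + 𝔔₀ * W₂ = 0)
    (hPW : (P * W₀).det ≠ 0) (hTW : (fromRows (τ₂ * Q₁₀) τ₁ * W₀).det ≠ 0) (hPW' : (P * W'₀).det ≠ 0)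
    {Γ : Matrix ν ν ℝ} {I : Matrix ν (μ ⊕ ρ₁) ℝ} {L : Matrix (μ ⊕ ρ₁) ν ℝ} {S : Matrix (μ ⊕ ρ₁) (μ ⊕ ρ₁) ℝ} {B : Matrix (μ ⊕ ρ₁) ν ℝ}
    (hΓ : flucCov H₀ (fromRows Q₁₀ τ₁) = Γ) (hI : minOp H₀ (fromRows Q₁₀ τ₁) = I) (hL : minOpL H₀ (fromRows Q₁₀ τ₁) = L) (hS : effForm H₀ (fromRows Q₁₀ τ₁) = S)
    (hB : fromRows Q₁₁ (0 : Matrix ρ₁ ν ℝ) = B)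
    (h1 : (kkt H₀ (fromRows Q₁₀ τ₁)).det ≠ 0)
    (h2 : (kkt (S.toBlocks₁₁ + G₀) (fromRows Q₂₀ τ₂)).det ≠ 0) :
    secondVar (kkt 𝔎'₀ (fromRows 𝔔'₀ P)) (kkt 𝔎'₁ (fromRows 𝔔'₁ (0 : Matrix (ρ₂ ⊕ ρ₁) ν ℝ))) (kkt 𝔎'₂ (fromRows 𝔔'₂ (0 : Matrix (ρ₂ ⊕ ρ₁) ν ℝ)))
      = secondVar (kkt H₀ (fromRows Q₁₀ τ₁)) (kkt H₁ B) (kkt H₂ (fromRows Q₁₂ (0 : Matrix ρ₁ ν ℝ)))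
        + secondVar
            (kkt (S.toBlocks₁₁ + G₀) (fromRows Q₂₀ τ₂))
            (kkt (((L * H₁ - S * B) * I - L * Bᵀ * S).toBlocks₁₁ + G₁) (fromRows Q₂₁ (0 : Matrix ρ₂ μ ℝ)))
            (kkt ((((-((L * H₁ - S * B) * Γ + L * Bᵀ * L) * H₁ + L * H₂
                      - (((L * H₁ - S * B) * I - L * Bᵀ * S) * B + S * fromRows Q₁₂ (0 : Matrix ρ₁ ν ℝ))) * I
                    + (L * H₁ - S * B) * (-((Γ * H₁ + I * B) * I - Γ * Bᵀ * S)))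
                  - ((-((L * H₁ - S * B) * Γ + L * Bᵀ * L) * Bᵀ + L * (fromRows Q₁₂ (0 : Matrix ρ₁ ν ℝ))ᵀ) * S
                      + L * Bᵀ * ((L * H₁ - S * B) * I - L * Bᵀ * S))).toBlocks₁₁ + G₂)
              (fromRows Q₂₂ (0 : Matrix ρ₂ μ ℝ))) := by
  -- the moved one-shot Faddeev–Popov operator is the one-shot chart's, re-parametrised
  have hPAW : (P * A'₀ * W₀).det ≠ 0 := by
    rw [Matrix.mul_assoc, j0, ← Matrix.mul_assoc, Matrix.det_mul]; exact mul_ne_zero hPW' hC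
  rw [secondVar_oneShot_nestedStepLaw_transported H₀ H₁ H₂ Q₁₀ Q₁₁ Q₁₂ Q₂₀ Q₂₁ Q₂₂ G₀ G₁ G₂ τ₁ τ₂ P W₀ W₁ W₂ Y₀ Y₁ Y₂ Y'₀ Y'₁ Y'₂
      A₀ A₁ A₂ A'₀ A'₁ A'₂ Ā₀ Ā₁ Ā₂ h𝔎₀ h𝔎₁ h𝔎₂ h𝔔₀ h𝔔₁ h𝔔₂ k0 k1 k2 q0 q1 q2 hA hĀ i0 i1 i2 uA uĀ a0 a1 a2 a0t a1t a2t b0 b1 b2 hPW hTW hPAW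
      hΓ hI hL hS hB h1 h2,
    secondVar_movedOneShotFP_eq_zero P W₀ W₁ W₂ W'₀ W'₁ W'₂ A'₀ A'₁ A'₂ C₀ C₁ C₂ j0 j1 j2 hPW' hC uC p1 p2,
    secondVar_nestedFP_eq_zero τ₁ τ₂ Q₁₀ Q₁₁ Q₁₂ W₀ W₁ W₂ s1 s2 t1 t2, mul_zero, sub_zero, add_zero]

/-! ## §3 (v1.1 APPEND) The same under the two chart-native (UNI)-jet letters — dead rows OR forest unimodularity, the caller's choice -/

omit [Fintype μ] [Fintype κ] [DecidableEq ν] [DecidableEq μ] [DecidableEq κ] in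
/-- [folklore] **THE MOVED ONE-SHOT FADDEEV–POPOV 2-JET UNDER THE INTERTWINING LETTER AND THE ONE-SHOT CHART'S (UNI)-JET LETTER**: `(A′·W)ₙ = (W♯·C)ₙ`, `C`
unimodular at jet level, and `secondVar (P·W♯)-jets = 0` (by dead rows `P·W♯₁ = P·W♯₂ = 0`, OR by forest-triangularity of the comb Faddeev–Popov operator along ANY
family — `ForestTriangularJets`) ⇒ `secondVar ((P·A′)·W)-jets = 0`. -/
theorem secondVar_movedOneShotFP_eq_zero_of_uni (P : Matrix (ρ₂ ⊕ ρ₁) ν ℝ) (W₀ W₁ W₂ W'₀ W'₁ W'₂ : Matrix ν (ρ₂ ⊕ ρ₁) ℝ) (A'₀ A'₁ A'₂ : Matrix ν ν ℝ)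
    (C₀ C₁ C₂ : Matrix (ρ₂ ⊕ ρ₁) (ρ₂ ⊕ ρ₁) ℝ)
    (j0 : A'₀ * W₀ = W'₀ * C₀) (j1 : A'₁ * W₀ + A'₀ * W₁ = W'₁ * C₀ + W'₀ * C₁)
    (j2 : A'₂ * W₀ + (2 : ℝ) • (A'₁ * W₁) + A'₀ * W₂ = W'₂ * C₀ + (2 : ℝ) • (W'₁ * C₁) + W'₀ * C₂)
    (hPW' : (P * W'₀).det ≠ 0) (hC : C₀.det ≠ 0) (uC : secondVar C₀ C₁ C₂ = 0) (uP' : secondVar (P * W'₀) (P * W'₁) (P * W'₂) = 0) :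
    secondVar (P * A'₀ * W₀) (P * A'₁ * W₀ + P * A'₀ * W₁) (P * A'₂ * W₀ + P * A'₁ * W₁ + (P * A'₁ * W₁ + P * A'₀ * W₂)) = 0 := by
  have w0 : P * A'₀ * W₀ = P * W'₀ * C₀ := by rw [Matrix.mul_assoc, j0, ← Matrix.mul_assoc]
  have w1 : P * A'₁ * W₀ + P * A'₀ * W₁ = P * W'₁ * C₀ + P * W'₀ * C₁ := by
    rw [Matrix.mul_assoc, Matrix.mul_assoc, ← Matrix.mul_add, j1, Matrix.mul_add, ← Matrix.mul_assoc, ← Matrix.mul_assoc]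
  have w2 : P * A'₂ * W₀ + P * A'₁ * W₁ + (P * A'₁ * W₁ + P * A'₀ * W₂) = P * W'₂ * C₀ + P * W'₁ * C₁ + (P * W'₁ * C₁ + P * W'₀ * C₂) := by
    have e : P * (A'₂ * W₀ + (2 : ℝ) • (A'₁ * W₁) + A'₀ * W₂) = P * (W'₂ * C₀ + (2 : ℝ) • (W'₁ * C₁) + W'₀ * C₂) := by rw [j2]
    simp only [Matrix.mul_add, two_smul, ← Matrix.mul_assoc] at e
    calc P * A'₂ * W₀ + P * A'₁ * W₁ + (P * A'₁ * W₁ + P * A'₀ * W₂)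
        = P * A'₂ * W₀ + (P * A'₁ * W₁ + P * A'₁ * W₁) + P * A'₀ * W₂ := by abel
      _ = P * W'₂ * C₀ + (P * W'₁ * C₁ + P * W'₁ * C₁) + P * W'₀ * C₂ := e
      _ = P * W'₂ * C₀ + P * W'₁ * C₁ + (P * W'₁ * C₁ + P * W'₀ * C₂) := by abel
  rw [w0, w1, w2, secondVar_mul₂ (P * W'₀) (P * W'₁) (P * W'₂) C₀ C₁ C₂ hPW' hC, uC, add_zero, uP']

/-- [folklore] **THE ONE-SHOT-SLICED COMPOSITE STEP LAW, TRANSPORT FIRST, UNDER THE CHART-NATIVE (UNI)-JET LETTERS: ZERO DEFECT.**  As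
`secondVar_oneShot_nestedStepLaw_transported_of_letters`, with the six dead-row letters REPLACED by the two (UNI)-jet letters each chart supplies by the
mechanism of its choice — `uP♯ : secondVar (P·W♯₀) (P·W♯₁) (P·W♯₂) = 0` (one-shot chart; dead rows or `ForestTriangularJets`) and
`uT : secondVar ([τ₂Q₁;τ₁]·W)-jets = 0` (nested chart; dead rows via `secondVar_nestedFP_eq_zero`, or forest ∕ `NestedStepLawOneShotLetters` §3). -/
theorem secondVar_oneShot_nestedStepLaw_transported_of_uni
    (H₀ H₁ H₂ : Matrix ν ν ℝ) (Q₁₀ Q₁₁ Q₁₂ : Matrix μ ν ℝ) (Q₂₀ Q₂₁ Q₂₂ : Matrix κ μ ℝ) (G₀ G₁ G₂ : Matrix μ μ ℝ)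
    (τ₁ : Matrix ρ₁ ν ℝ) (τ₂ : Matrix ρ₂ μ ℝ) (P : Matrix (ρ₂ ⊕ ρ₁) ν ℝ) (W₀ W₁ W₂ : Matrix ν (ρ₂ ⊕ ρ₁) ℝ) (Y₀ Y₁ Y₂ Y'₀ Y'₁ Y'₂ : Matrix κ (ρ₂ ⊕ ρ₁) ℝ)
    (A₀ A₁ A₂ A'₀ A'₁ A'₂ : Matrix ν ν ℝ) (Ā₀ Ā₁ Ā₂ : Matrix κ κ ℝ)
    (W'₀ W'₁ W'₂ : Matrix ν (ρ₂ ⊕ ρ₁) ℝ) (C₀ C₁ C₂ : Matrix (ρ₂ ⊕ ρ₁) (ρ₂ ⊕ ρ₁) ℝ)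
    {𝔎₀ 𝔎₁ 𝔎₂ : Matrix ν ν ℝ} {𝔔₀ 𝔔₁ 𝔔₂ : Matrix κ ν ℝ}
    (h𝔎₀ : H₀ + Q₁₀ᵀ * G₀ * Q₁₀ = 𝔎₀) (h𝔎₁ : H₁ + (Q₁₁ᵀ * G₀ * Q₁₀ + Q₁₀ᵀ * G₁ * Q₁₀ + Q₁₀ᵀ * G₀ * Q₁₁) = 𝔎₁)
    (h𝔎₂ : H₂ + ((Q₁₂ᵀ * G₀ * Q₁₀ + Q₁₁ᵀ * G₁ * Q₁₀ + Q₁₁ᵀ * G₀ * Q₁₁) + (Q₁₁ᵀ * G₁ * Q₁₀ + Q₁₀ᵀ * G₂ * Q₁₀ + Q₁₀ᵀ * G₁ * Q₁₁)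
            + (Q₁₁ᵀ * G₀ * Q₁₁ + Q₁₀ᵀ * G₁ * Q₁₁ + Q₁₀ᵀ * G₀ * Q₁₂)) = 𝔎₂)
    (h𝔔₀ : Q₂₀ * Q₁₀ = 𝔔₀) (h𝔔₁ : Q₂₁ * Q₁₀ + Q₂₀ * Q₁₁ = 𝔔₁) (h𝔔₂ : Q₂₂ * Q₁₀ + Q₂₁ * Q₁₁ + (Q₂₁ * Q₁₁ + Q₂₀ * Q₁₂) = 𝔔₂)
    {𝔎'₀ 𝔎'₁ 𝔎'₂ : Matrix ν ν ℝ} {𝔔'₀ 𝔔'₁ 𝔔'₂ : Matrix κ ν ℝ}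
    (k0 : A₀ᵀ * 𝔎₀ * A₀ = 𝔎'₀) (k1 : A₁ᵀ * 𝔎₀ * A₀ + A₀ᵀ * 𝔎₁ * A₀ + A₀ᵀ * 𝔎₀ * A₁ = 𝔎'₁)
    (k2 : A₂ᵀ * 𝔎₀ * A₀ + (A₁ᵀ * 𝔎₁ * A₀ + A₁ᵀ * 𝔎₀ * A₁)
            + ((A₁ᵀ * 𝔎₁ * A₀ + A₁ᵀ * 𝔎₀ * A₁) + (A₀ᵀ * 𝔎₂ * A₀ + A₀ᵀ * 𝔎₁ * A₁ + (A₀ᵀ * 𝔎₁ * A₁ + A₀ᵀ * 𝔎₀ * A₂))) = 𝔎'₂)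
    (q0 : Ā₀ * 𝔔₀ * A₀ = 𝔔'₀) (q1 : Ā₁ * 𝔔₀ * A₀ + Ā₀ * 𝔔₁ * A₀ + Ā₀ * 𝔔₀ * A₁ = 𝔔'₁)
    (q2 : Ā₂ * 𝔔₀ * A₀ + (Ā₁ * 𝔔₁ * A₀ + Ā₁ * 𝔔₀ * A₁)
            + ((Ā₁ * 𝔔₁ * A₀ + Ā₁ * 𝔔₀ * A₁) + (Ā₀ * 𝔔₂ * A₀ + Ā₀ * 𝔔₁ * A₁ + (Ā₀ * 𝔔₁ * A₁ + Ā₀ * 𝔔₀ * A₂))) = 𝔔'₂)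
    (hA : A₀.det ≠ 0) (hĀ : Ā₀.det ≠ 0)
    (i0 : A'₀ * A₀ = 1) (i1 : A'₁ * A₀ + A'₀ * A₁ = 0) (i2 : A'₂ * A₀ + (2 : ℝ) • (A'₁ * A₁) + A'₀ * A₂ = 0)
    (uA : secondVar A₀ A₁ A₂ = 0) (uĀ : secondVar Ā₀ Ā₁ Ā₂ = 0)
    (j0 : A'₀ * W₀ = W'₀ * C₀) (j1 : A'₁ * W₀ + A'₀ * W₁ = W'₁ * C₀ + W'₀ * C₁)
    (j2 : A'₂ * W₀ + (2 : ℝ) • (A'₁ * W₁) + A'₀ * W₂ = W'₂ * C₀ + (2 : ℝ) • (W'₁ * C₁) + W'₀ * C₂)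
    (hC : C₀.det ≠ 0) (uC : secondVar C₀ C₁ C₂ = 0)
    -- the two chart-native (UNI)-jet letters
    (uP' : secondVar (P * W'₀) (P * W'₁) (P * W'₂) = 0)
    (uT : secondVar (fromRows (τ₂ * Q₁₀) τ₁ * W₀) (fromRows (τ₂ * Q₁₁) (0 : Matrix ρ₁ ν ℝ) * W₀ + fromRows (τ₂ * Q₁₀) τ₁ * W₁)
      (fromRows (τ₂ * Q₁₂) (0 : Matrix ρ₁ ν ℝ) * W₀ + fromRows (τ₂ * Q₁₁) (0 : Matrix ρ₁ ν ℝ) * W₁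
        + (fromRows (τ₂ * Q₁₁) (0 : Matrix ρ₁ ν ℝ) * W₁ + fromRows (τ₂ * Q₁₀) τ₁ * W₂)) = 0)
    (a0 : 𝔎₀ * W₀ = 𝔔₀ᵀ * Y₀) (a1 : 𝔎₁ * W₀ + 𝔎₀ * W₁ = 𝔔₁ᵀ * Y₀ + 𝔔₀ᵀ * Y₁)
    (a2 : 𝔎₂ * W₀ + (2 : ℝ) • (𝔎₁ * W₁) + 𝔎₀ * W₂ = 𝔔₂ᵀ * Y₀ + (2 : ℝ) • (𝔔₁ᵀ * Y₁) + 𝔔₀ᵀ * Y₂)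
    (a0t : 𝔎₀ᵀ * W₀ = 𝔔₀ᵀ * Y'₀) (a1t : 𝔎₁ᵀ * W₀ + 𝔎₀ᵀ * W₁ = 𝔔₁ᵀ * Y'₀ + 𝔔₀ᵀ * Y'₁)
    (a2t : 𝔎₂ᵀ * W₀ + (2 : ℝ) • (𝔎₁ᵀ * W₁) + 𝔎₀ᵀ * W₂ = 𝔔₂ᵀ * Y'₀ + (2 : ℝ) • (𝔔₁ᵀ * Y'₁) + 𝔔₀ᵀ * Y'₂)
    (b0 : 𝔔₀ * W₀ = 0) (b1 : 𝔔₁ * W₀ + 𝔔₀ * W₁ = 0) (b2 : 𝔔₂ * W₀ + (2 : ℝ) • (𝔔₁ * W₁) + 𝔔₀ * W₂ = 0)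
    (hPW : (P * W₀).det ≠ 0) (hTW : (fromRows (τ₂ * Q₁₀) τ₁ * W₀).det ≠ 0) (hPW' : (P * W'₀).det ≠ 0)
    {Γ : Matrix ν ν ℝ} {I : Matrix ν (μ ⊕ ρ₁) ℝ} {L : Matrix (μ ⊕ ρ₁) ν ℝ} {S : Matrix (μ ⊕ ρ₁) (μ ⊕ ρ₁) ℝ} {B : Matrix (μ ⊕ ρ₁) ν ℝ}
    (hΓ : flucCov H₀ (fromRows Q₁₀ τ₁) = Γ) (hI : minOp H₀ (fromRows Q₁₀ τ₁) = I) (hL : minOpL H₀ (fromRows Q₁₀ τ₁) = L) (hS : effForm H₀ (fromRows Q₁₀ τ₁) = S)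
    (hB : fromRows Q₁₁ (0 : Matrix ρ₁ ν ℝ) = B)
    (h1 : (kkt H₀ (fromRows Q₁₀ τ₁)).det ≠ 0)
    (h2 : (kkt (S.toBlocks₁₁ + G₀) (fromRows Q₂₀ τ₂)).det ≠ 0) :
    secondVar (kkt 𝔎'₀ (fromRows 𝔔'₀ P)) (kkt 𝔎'₁ (fromRows 𝔔'₁ (0 : Matrix (ρ₂ ⊕ ρ₁) ν ℝ))) (kkt 𝔎'₂ (fromRows 𝔔'₂ (0 : Matrix (ρ₂ ⊕ ρ₁) ν ℝ)))
      = secondVar (kkt H₀ (fromRows Q₁₀ τ₁)) (kkt H₁ B) (kkt H₂ (fromRows Q₁₂ (0 : Matrix ρ₁ ν ℝ)))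
        + secondVar
            (kkt (S.toBlocks₁₁ + G₀) (fromRows Q₂₀ τ₂))
            (kkt (((L * H₁ - S * B) * I - L * Bᵀ * S).toBlocks₁₁ + G₁) (fromRows Q₂₁ (0 : Matrix ρ₂ μ ℝ)))
            (kkt ((((-((L * H₁ - S * B) * Γ + L * Bᵀ * L) * H₁ + L * H₂
                      - (((L * H₁ - S * B) * I - L * Bᵀ * S) * B + S * fromRows Q₁₂ (0 : Matrix ρ₁ ν ℝ))) * I
                    + (L * H₁ - S * B) * (-((Γ * H₁ + I * B) * I - Γ * Bᵀ * S)))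
                  - ((-((L * H₁ - S * B) * Γ + L * Bᵀ * L) * Bᵀ + L * (fromRows Q₁₂ (0 : Matrix ρ₁ ν ℝ))ᵀ) * S
                      + L * Bᵀ * ((L * H₁ - S * B) * I - L * Bᵀ * S))).toBlocks₁₁ + G₂)
              (fromRows Q₂₂ (0 : Matrix ρ₂ μ ℝ))) := by
  have hPAW : (P * A'₀ * W₀).det ≠ 0 := by
    rw [Matrix.mul_assoc, j0, ← Matrix.mul_assoc, Matrix.det_mul]; exact mul_ne_zero hPW' hC
  rw [secondVar_oneShot_nestedStepLaw_transported H₀ H₁ H₂ Q₁₀ Q₁₁ Q₁₂ Q₂₀ Q₂₁ Q₂₂ G₀ G₁ G₂ τ₁ τ₂ P W₀ W₁ W₂ Y₀ Y₁ Y₂ Y'₀ Y'₁ Y'₂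
      A₀ A₁ A₂ A'₀ A'₁ A'₂ Ā₀ Ā₁ Ā₂ h𝔎₀ h𝔎₁ h𝔎₂ h𝔔₀ h𝔔₁ h𝔔₂ k0 k1 k2 q0 q1 q2 hA hĀ i0 i1 i2 uA uĀ a0 a1 a2 a0t a1t a2t b0 b1 b2 hPW hTW hPAW
      hΓ hI hL hS hB h1 h2,
    secondVar_movedOneShotFP_eq_zero_of_uni P W₀ W₁ W₂ W'₀ W'₁ W'₂ A'₀ A'₁ A'₂ C₀ C₁ C₂ j0 j1 j2 hPW' hC uC uP', uT, mul_zero, sub_zero, add_zero]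

end Summit.QuantumFields.BalabanUV.Beta.FP.NestedStepLawTransported

end
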